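import Summits.ResolutionOfSingularities.ResolutionOfSingularities.Theorems.WeightedInvariantIota3TauDescentAdaptedRsp
import HarnessLib

/-!
# (desc-τ) IN THE DOOR SETTING ⟸ (ADAPT-adm) AT STEEP WEIGHTS ONLY: the descent of tie positions for bases essentially of finite type over a field,
# reduced to the admissibility of an rsp-adapted pair when the tie upstairs has weights `q < r`
# (door `HypersurfaceCentreConstruction`, stmt-ResolutionOfSingularities-19897; gap (1) (desc-τ) — final reduction of this hand)

Topic: `Summits/ResolutionOfSingularities/ResolutionOfSingularities/Theorems`. Helper for the door item `HypersurfaceCentreConstruction`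
(stmt-ResolutionOfSingularities-19897, route `WeightedInvariant`), line `local-engine`, def-free.  Audit glue over …TauDescentDoor / …Adapt / …AdaptedRsp:

  **`Iota3.isTiePosition_descent_door_of_adm`** — for `T` regular local essentially of finite type over a field and `φ : T → T'` local, formally smooth,
  essentially of finite type into a regular local `T'` with `dim T' ≤ 3`: `IsTiePosition T' (φ g) → IsTiePosition T g`, GIVEN ONLY (ADAPT-adm): «if
  `dim T = dim T' = 3`, `𝔪_T T' = 𝔪'` and `(T', φ g)` has a tie presentation `(x', y', z'; q, r; λ')` with `q < r` and order `ν`, then some regular system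
  of parameters `(x, y, z)` of `T` with `(x, y) = P₀(T, g)` has `g/1 ∈ 𝒥_{rν}((y/1, x/1); (r, q))` in `T_{P₀}`».
  (Cases `dim T ≤ 2`: …LowDim / …ExtReesBaseChange; `dim T = 3`, `q = r`: `isTiePosition_descent_of_weights_one`; `q < r`: `isTiePosition_of_adapted_admissible`.)
  A proof sketch of (ADAPT-adm) (induction on the transversal order, normality of `T ⧸ P₀`, unique factorisation in `T ⧸ (Y₀)`) is in the memo
  TAU-DESCENT-A.md §7.

[OURS · L1 W4.3 · (desc-τ) door setting ⟸ (ADAPT-adm)]  Replaces the role of NO printed item; NOT a statement of the manuscript under review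
[claim: Hironaka2017, status: under-review]; candidates stay candidates; AI work, weaker than expert review.  No definition; no axiom; (ADAPT-adm) is a hypothesis.
-/

noncomputable section

set_option linter.dupNamespace false -- mandated namespace `Summit.<Summit>.<Problem>` of this single-conjunct summit

open IsLocalRing Literature.AlgebraicGeometry.Resolution
open Summit.ResolutionOfSingularities.ResolutionOfSingularities.Theorems
open Summit.ResolutionOfSingularities.ResolutionOfSingularities.Theorems.ContactCylinder

namespace Summit.ResolutionOfSingularities.ResolutionOfSingularities.Cruxes.HypersurfaceCentreConstruction.LocalEngine

namespace Iota3

/-- **(desc-τ) IN THE DOOR SETTING FROM (ADAPT-adm) AT STEEP WEIGHTS.**  See the module docstring. [OURS · audit glue]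
[cite: AbramovichQuekSchober2025, Thm 1.3, Thm 3.5] -/
theorem isTiePosition_descent_door_of_adm (T T' : Type) [CommRing T] [CommRing T'] [IsRegularLocalRing T] [IsRegularLocalRing T']
    [Algebra T T'] [IsLocalHom (algebraMap T T')] [Algebra.FormallySmooth T T'] [Algebra.EssFiniteType T T']
    (k₀ : Type) [Field k₀] [Algebra k₀ T] [Algebra.EssFiniteType k₀ T] {g : T}
    (hadm : ringKrullDim T = (3 : ℕ) → ringKrullDim T' = (3 : ℕ) → (maximalIdeal T).map (algebraMap T T') = maximalIdeal T' →
      ∀ (x' y' z' : T') (q r : ℕ) (lam' : T') (ν : ℕ), q < r → IsTiePresentation T' (algebraMap T T' g) x' y' z' q r lam' →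
      algebraMap T T' g ∈ maximalIdeal T' ^ ν → algebraMap T T' g ∉ maximalIdeal T' ^ (ν + 1) →
      ∃ (x y z : T) (_ : (Ideal.span ({x, y} : Set T)).IsPrime),
        Ideal.span {x, y, z} = maximalIdeal T ∧ topStratumPrime iotaOrdEps T g = Ideal.span {x, y} ∧
        algebraMap T (Localization.AtPrime (Ideal.span ({x, y} : Set T))) g ∈
          weightedMonomialIdeal ![algebraMap T (Localization.AtPrime (Ideal.span ({x, y} : Set T))) y,
            algebraMap T (Localization.AtPrime (Ideal.span ({x, y} : Set T))) x] ![r, q] (r * ν))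
    (_hdimT' : ringKrullDim T' ≤ 3) (ht' : IsTiePosition T' (algebraMap T T' g)) : IsTiePosition T g := by
  obtain ⟨h3', h2 | h3⟩ := ringKrullDim_eq_of_isTiePosition_map T T' ht'
  · exact absurd ht' (not_isTiePosition_map_of_ringKrullDim_eq_two T T' k₀ h2 g)
  · have h𝔪 : (maximalIdeal T).map (algebraMap T T') = maximalIdeal T' :=
      EssSmoothLE2.map_maximalIdeal_eq_of_ringKrullDim_eq T T' (by rw [h3, h3'])
    obtain ⟨_, -, -, -, x', y', z', q, r, lam', h'⟩ := id ht'
    obtain ⟨-, -, ν, hP', hfν, hfν1, hlex, -⟩ := id h'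
    -- weights: `q ≤ r`, coprime; so `q = r` means `(1, 1)`
    obtain ⟨-, hpos, hcop, hqr, -⟩ := hlex
    rcases (show q ≤ r from hqr).eq_or_lt with hqr_eq | hlt
    · -- `q = r`, hence `q = r = 1`
      subst hqr_eq
      have hq1 : q = 1 := by
        have hc : Nat.Coprime q q := hcop
        unfold Nat.Coprime at hc
        rwa [Nat.gcd_self] at hc
      subst hq1
      exact isTiePosition_descent_of_weights_one T T' h3 ht' h'
    · obtain ⟨x, y, z, hP, hxyz, hP₀, hmem⟩ := hadm h3 h3' h𝔪 x' y' z' q r lam' ν hlt h' hfν hfν1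
      haveI := hP
      exact isTiePosition_of_adapted_admissible T T' h3 ht' h' hfν hfν1 hxyz hP₀ hmem

end Iota3

end Summit.ResolutionOfSingularities.ResolutionOfSingularities.Cruxes.HypersurfaceCentreConstruction.LocalEngine

end
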